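/- Copyright: the b2b-balaban cell (near-miss cell 7), T⁴-continuum fan-out, lineage t4-ne7b-p1 (node U5c COUNT
member).  Released under the licence of the surrounding project. -/
import Summits.QuantumFields.BalabanUV.T4Continuum.Support.HistoryGenealogyExtractionRLedger
import Summits.QuantumFields.BalabanUV.T4Continuum.Support.HistoryGenealogyExtractionAncestors
import Summits.QuantumFields.BalabanUV.T4Continuum.Support.HistoryGenealogyExtractionCount

/-!
# Genealogy extraction with per-part renewals — THE ORDER-FREE BIRTH KEY, ROOT INJECTIVITY and THE FOREST REGION
COUNT for `pgenR` (H3-(ID), combinatorial half v2; the `pgenR` twins of row S13's `…Ancestors`∕`…Count`; owner module of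
row NE7b, lineage `t4-ne7b-p1` gen 40, ruling R-OWNER-40-3 (repair R-40-b of F-ne7bp1g40-2) — PRE-POSITIONING ONLY)

Summits-side support leaf of the T⁴-continuum cell (rung (B)+1 on a FINITE torus only; NOT infinite volume, NOT the
mass gap, NOT the Clay statement; NOT a proof of the spine estimate NE7b, which is the cell's OWN estimate, NOT PRINTED
and NOT PROVED).  [folklore] finite combinatorics over `HistoryGenealogyExtractionR`∕`…RLedger` (`pgenR`, `wrapR`,
`assembleR`, `constituentsR`, `regions_pgenR_*`) and row S13's `…Ancestors` (`anc`, `anc_disjoint`, `anc_subset_comp`,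
`btag`, `map_pbirths_births`, `nodup_sum_map`, `nodup_map_btag`, `root_mem_pbirths`, `pbirths_joinTail`) ∕ `…Count`
∕ `…Ledger` (`sum_comp_eq_continued_add_died`, `sum_length_news_le_card_newReg`), all flag-free and reused verbatim;
`HistorySiblingEntropySortPhys.PGen.pbirths`; nothing printed is asserted, zero `sorry`.  B16 = [Balaban1989LargeFieldII]
pp. 383–387 under audit; locators only.

WHY.  The junction M4 keys the count's slots on the (root step, root cell) of each maximal structure and needs this key
to be INJECTIVE on the components of a level, for the per-part-renewal extraction `pgenR` that M3b-2 instantiates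
(`RunInput.hist`); renewals book no birth, so row S13's order-free key transfers verbatim.

WHAT IS PROVED.  `pbirths_assembleR`, `pbirths_wrapR`; **`pbirths_pgenR_succ`**∕`_zero` (one-step equation of the key);
**`mem_pbirths_pgenR_iff`** (closed form: the tags of the new regions of the ancestors), `step_le_of_mem_pbirths_pgenR`,
**`pbirths_pgenR_disjoint`**, **`pbirths_pgenR_nodup`**, **`root_injectiveR`** (distinct components of one level have
distinct (root step, root cell)); **`forest_regions_eqR`**∕`forest_regions_leR`∕`live_regions_leR` (the constituent
regions of the forest number the booked births, at most the new regions ever created).  Row S13's `card_forest_le`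
is flag-free and applies to `pgenR`'s forest unchanged.

HONEST.  Proves nothing of Bałaban's; NE7b NOT proved; spine 0∕9.  HONEST DEPENDENCY (cell): continuum YM on T⁴ ⇐
BetaPertH ∧ nine spine estimates (0/9 proved); BetaPertH ⇐ (D1) ∧ (D4) ∧ CAP+tail; G-an2-4 gates asym, D1 and NE2/3/4.
This file changes none of it. -/

open Finset
open Literature.MathematicalPhysics.QuantumFieldTheory.Balaban1983to89

namespace Summit.QuantumFields.BalabanUV.T4Continuum.HistoryGenealogyExtraction

open HistoryAdmissible HistoryAdmissible.PGen T4PersistenceDictionary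

/-! ## §1 The birth key through `assembleR` and `wrapR` -/

section PBirthsR

variable {γ : Type*}

/-- the birth key of an `assembleR`d genealogy with a nonempty constituent list is the sum over the constituents
[folklore] -/
theorem pbirths_assembleR (c : γ) (s : ℕ) :
    ∀ L : List (PGen γ), L ≠ [] → (assembleR c s L).pbirths = (L.map PGen.pbirths).sum
  | [], hL => (hL rfl).elim
  | [T], _ => by simp [assembleR]
  | T :: U :: L, _ => by simp [assembleR, pbirths_joinTail]

/-- a renewal wrapper books no birth [folklore] -/
@[simp] theorem pbirths_wrapR (rnw : ℕ → γ → Bool) (rec : γ → PGen γ) (j : ℕ) (p : γ) :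
    (wrapR rnw rec j p).pbirths = (rec p).pbirths := by
  unfold wrapR; split_ifs <;> simp

end PBirthsR

/-! ## §2 The key along `pgenR`: one-step equation, closed form, disjointness, root injectivity -/

namespace ComponentHistory

variable {γ : Type*} [DecidableEq γ] (H : ComponentHistory γ) (rnw : ℕ → γ → Bool)

/-- **ONE-STEP EQUATION OF THE BIRTH KEY** (under `WF`, `c ∈ comp (j+1)`): the key of the genealogy of `c` is the sum of
its parts' keys plus one tagged entry per new region inside. [folklore] -/
theorem pbirths_pgenR_succ (hW : H.WF) (j : ℕ) (c : γ) (hc : c ∈ H.comp (j + 1)) :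
    (H.pgenR rnw (j + 1) c).pbirths =
      ((H.parts (j + 1) c).map fun p => (H.pgenR rnw j p).pbirths).sum + ↑((H.news (j + 1) c).map (H.btag (j + 1))) := by
  rw [pgenR_succ_eq, pbirths_assembleR c (j + 1) _ (H.constituentsR_ne_nil rnw hW _ hc), H.sum_map_constituentsR,
    map_pbirths_births]
  simp only [pbirths_wrapR]

/-- the birth key at level `0` (under `WF`, `c ∈ comp 0`): one tagged entry per new region [folklore] -/
theorem pbirths_pgenR_zero (hW : H.WF) (c : γ) (hc : c ∈ H.comp 0) :
    (H.pgenR rnw 0 c).pbirths = ↑((H.news 0 c).map (H.btag 0)) := by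
  rw [pgenR_zero_eq, pbirths_assembleR c 0 _ (H.births_zero_ne_nil hW hc), births, List.map_map]
  exact H.map_pbirths_births 0 c

/-! ## §3 The closed form of the birth key, disjointness and duplicate-freeness -/

/-- **THE CLOSED FORM** (under `WF`, `c ∈ comp j`): an entry `(e, n)` is booked in the key of `pgen j c` iff it is the
tag of a new region `n ∈ news i a` of an ancestor `a ∈ anc j c i` at some level `i ≤ j`. [folklore] -/
theorem mem_pbirths_pgenR_iff (hW : H.WF) :
    ∀ (j : ℕ) (c : γ), c ∈ H.comp j → ∀ x : PEv × γ,
      x ∈ (H.pgenR rnw j c).pbirths ↔ ∃ i ≤ j, ∃ a ∈ H.anc j c i, x.2 ∈ H.news i a ∧ x = H.btag i x.2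
  | 0, c, hc, x => by
      rw [H.pbirths_pgenR_zero rnw hW c hc, Multiset.mem_coe, List.mem_map]
      constructor
      · rintro ⟨n, hn, rfl⟩
        exact ⟨0, le_rfl, c, by simp, hn, rfl⟩
      · rintro ⟨i, hi, a, ha, hn, hx⟩
        obtain rfl : i = 0 := Nat.le_zero.1 hi
        simp only [anc_self, Finset.mem_singleton] at ha
        subst ha
        exact ⟨x.2, hn, hx.symm⟩
  | j + 1, c, hc, x => by
      rw [H.pbirths_pgenR_succ rnw hW j c hc, Multiset.mem_add, Multiset.mem_coe, List.mem_map]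
      have hsum : x ∈ ((H.parts (j + 1) c).map fun p => (H.pgenR rnw j p).pbirths).sum ↔
          ∃ p ∈ H.parts (j + 1) c, x ∈ (H.pgenR rnw j p).pbirths := by
        generalize H.parts (j + 1) c = L
        induction L with
        | nil => simp
        | cons q L ih => simp [ih]
      rw [hsum]
      constructor
      · rintro (⟨p, hp, hx⟩ | ⟨n, hn, rfl⟩)
        · obtain ⟨i, hi, a, ha, hn, hx'⟩ :=
            (mem_pbirths_pgenR_iff hW j p (hW.parts_sub j c hc p hp) x).1 hx
          exact ⟨i, by omega, a, (H.mem_anc_succ_iff hi c a).2 ⟨p, hp, ha⟩, hn, hx'⟩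
        · exact ⟨j + 1, le_rfl, c, by simp, hn, rfl⟩
      · rintro ⟨i, hi, a, ha, hn, hx⟩
        by_cases hij : i = j + 1
        · subst hij
          simp only [anc_self, Finset.mem_singleton] at ha
          subst ha
          exact Or.inr ⟨x.2, hn, hx.symm⟩
        · have hi' : i ≤ j := by omega
          obtain ⟨p, hp, hap⟩ := (H.mem_anc_succ_iff hi' c a).1 ha
          exact Or.inl ⟨p, hp, (mem_pbirths_pgenR_iff hW j p (hW.parts_sub j c hc p hp) x).2 ⟨i, hi', a, hap, hn, hx⟩⟩

/-- every booked birth of `pgen j c` happened at a step `≤ j` (under `WF`) [folklore] -/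
theorem step_le_of_mem_pbirths_pgenR (hW : H.WF) {j : ℕ} {c : γ} (hc : c ∈ H.comp j) {x : PEv × γ}
    (hx : x ∈ (H.pgenR rnw j c).pbirths) : x.1.1 ≤ j := by
  obtain ⟨i, hi, a, _, _, hx⟩ := (H.mem_pbirths_pgenR_iff rnw hW j c hc x).1 hx
  rw [hx]
  exact hi

/-- **DISTINCT COMPONENTS OF ONE LEVEL HAVE DISJOINT BIRTH KEYS** (under `WF`): no new region is booked in two live
structures — the order-free key separates the maximal structures. [folklore] -/
theorem pbirths_pgenR_disjoint (hW : H.WF) {j : ℕ} {c c' : γ} (hc : c ∈ H.comp j) (hc' : c' ∈ H.comp j)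
    (hne : c ≠ c') : Disjoint (H.pgenR rnw j c).pbirths (H.pgenR rnw j c').pbirths := by
  rw [Multiset.disjoint_iff_ne]
  rintro x hx _ hx' rfl
  obtain ⟨i, hi, a, ha, hn, hxe⟩ := (H.mem_pbirths_pgenR_iff rnw hW j c hc x).1 hx
  obtain ⟨i', _, a', ha', hn', hxe'⟩ := (H.mem_pbirths_pgenR_iff rnw hW j c' hc' x).1 hx'
  have hii : i = i' := by
    have h1 := congrArg (fun y : PEv × γ => y.1.1) (hxe.symm.trans hxe')
    simpa [btag] using h1
  subst hii
  by_cases haa : a = a'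
  · subst haa
    exact Finset.disjoint_left.1 (H.anc_disjoint hW j c c' hc hc' hne i) ha ha'
  · have hda := hW.news_disj i a a' (H.anc_subset_comp hW j c hc i ha) (H.anc_subset_comp hW j c' hc' i ha') haa
    exact Finset.disjoint_left.1 hda (List.mem_toFinset.2 hn) (List.mem_toFinset.2 hn')

/-- **THE BIRTH KEY IS DUPLICATE-FREE** (under `WF`). [folklore] -/
theorem pbirths_pgenR_nodup (hW : H.WF) : ∀ (j : ℕ) (c : γ), c ∈ H.comp j → (H.pgenR rnw j c).pbirths.Nodup
  | 0, c, hc => by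
      rw [H.pbirths_pgenR_zero rnw hW c hc, Multiset.coe_nodup]
      exact H.nodup_map_btag hW 0 c
  | j + 1, c, hc => by
      rw [H.pbirths_pgenR_succ rnw hW j c hc, Multiset.nodup_add]
      refine ⟨?_, Multiset.coe_nodup.2 (H.nodup_map_btag hW (j + 1) c), ?_⟩
      · exact nodup_sum_map (fun p => (H.pgenR rnw j p).pbirths) _ (hW.parts_nodup _ _)
          (fun p hp => pbirths_pgenR_nodup hW j p (hW.parts_sub j c hc p hp))
          (fun p hp p' hp' hne => H.pbirths_pgenR_disjoint rnw hW (hW.parts_sub j c hc p hp) (hW.parts_sub j c hc p' hp') hne)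
      · rw [Multiset.disjoint_iff_ne]
        rintro x hx _ hx' rfl
        -- `x` is booked in some part's key, hence at a step `≤ j`; the new entries sit at step `j + 1`
        have hsum : ∃ p ∈ H.parts (j + 1) c, x ∈ (H.pgenR rnw j p).pbirths := by
          revert hx
          generalize H.parts (j + 1) c = L
          induction L with
          | nil => simp
          | cons q L ih =>
              intro hx
              rw [List.map_cons, List.sum_cons, Multiset.mem_add] at hx
              rcases hx with hx | hx
              · exact ⟨q, by simp, hx⟩
              · obtain ⟨p, hp, hxp⟩ := ih hx
                exact ⟨p, by simp [hp], hxp⟩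
        obtain ⟨p, hp, hxp⟩ := hsum
        have hle := H.step_le_of_mem_pbirths_pgenR rnw hW (hW.parts_sub j c hc p hp) hxp
        rw [Multiset.mem_coe, List.mem_map] at hx'
        obtain ⟨n, -, hxn⟩ := hx'
        have : x.1.1 = j + 1 := by rw [← hxn]; rfl
        omega

/-- **THE ROOT SEPARATES THE LIVE STRUCTURES** (under `WF`): distinct components of one level have distinct (root step,
root cell) — the slot datum of the count (`BSlot`: root step, root cell, shape) is injective on the maximal structures
before the shape is even read. [folklore] -/
theorem root_injectiveR (hW : H.WF) {j : ℕ} {c c' : γ} (hc : c ∈ H.comp j) (hc' : c' ∈ H.comp j)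
    (hs : (H.pgenR rnw j c).rootStep = (H.pgenR rnw j c').rootStep) (hz : (H.pgenR rnw j c).rootCell = (H.pgenR rnw j c').rootCell) :
    c = c' := by
  by_contra hne
  obtain ⟨d, hd⟩ := root_mem_pbirths (H.pgenR rnw j c)
  obtain ⟨d', hd'⟩ := root_mem_pbirths (H.pgenR rnw j c')
  obtain ⟨i, -, a, -, -, hx⟩ := (H.mem_pbirths_pgenR_iff rnw hW j c hc _).1 hd
  obtain ⟨i', -, a', -, -, hx'⟩ := (H.mem_pbirths_pgenR_iff rnw hW j c' hc' _).1 hd'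
  have hdd : d = H.cls (H.pgenR rnw j c).rootCell := by simpa [btag] using congrArg (fun y : PEv × γ => y.1.2.2) hx
  have hdd' : d' = H.cls (H.pgenR rnw j c').rootCell := by simpa [btag] using congrArg (fun y : PEv × γ => y.1.2.2) hx'
  have heq : ((((H.pgenR rnw j c).rootStep, 0, d) : PEv), (H.pgenR rnw j c).rootCell) =
      ((((H.pgenR rnw j c').rootStep, 0, d') : PEv), (H.pgenR rnw j c').rootCell) := by
    rw [hdd, hdd', hs, hz]
  exact Multiset.disjoint_iff_ne.1 (H.pbirths_pgenR_disjoint rnw hW hc hc' hne) _ hd _ hd' heq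


/-! ## §3 The forest region count for `pgenR` -/

/-- **THE FOREST REGION COUNT** (under `WF`), `pgenR` form. [folklore] -/
theorem forest_regions_eqR (hW : H.WF) : ∀ K : ℕ,
    (∑ c ∈ H.comp K, (H.pgenR rnw K c).regions) + ∑ j ∈ Finset.range K, ∑ d ∈ H.died j, (H.pgenR rnw j d).regions =
      ∑ j ∈ Finset.range (K + 1), ∑ c ∈ H.comp j, (H.news j c).length
  | 0 => by
      rw [Finset.sum_range_zero, add_zero, Finset.sum_range_one]
      exact Finset.sum_congr rfl fun c hc => H.regions_pgenR_zero rnw hW c hc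
  | K + 1 => by
      have ih := forest_regions_eqR hW K
      have hstep : ∑ c ∈ H.comp (K + 1), (H.pgenR rnw (K + 1) c).regions =
          (∑ c ∈ H.comp (K + 1), ((H.parts (K + 1) c).map fun p => (H.pgenR rnw K p).regions).sum) +
            ∑ c ∈ H.comp (K + 1), (H.news (K + 1) c).length := by
        rw [← Finset.sum_add_distrib]
        exact Finset.sum_congr rfl fun c hc => H.regions_pgenR_succ rnw hW K c hc
      have htel := H.sum_comp_eq_continued_add_died hW K (fun a => (H.pgenR rnw K a).regions)
      rw [Finset.sum_range_succ _ (K + 1), Finset.sum_range_succ _ K, hstep, ← ih, htel]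
      omega

/-- **NO REGION IS BORN TWICE ACROSS THE FOREST** (under `WF`), `pgenR` form. [folklore] -/
theorem forest_regions_leR (hW : H.WF) (K : ℕ) :
    (∑ c ∈ H.comp K, (H.pgenR rnw K c).regions) + ∑ j ∈ Finset.range K, ∑ d ∈ H.died j, (H.pgenR rnw j d).regions ≤
      ∑ j ∈ Finset.range (K + 1), (H.newReg j).card := by
  rw [H.forest_regions_eqR rnw hW K]
  exact Finset.sum_le_sum fun j _ => H.sum_length_news_le_card_newReg hW j

/-- the live `pgenR` genealogies carry at most as many regions as were ever created [folklore] -/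
theorem live_regions_leR (hW : H.WF) (K : ℕ) :
    (∑ c ∈ H.comp K, (H.pgenR rnw K c).regions) ≤ ∑ j ∈ Finset.range (K + 1), (H.newReg j).card :=
  (Nat.le_add_right _ _).trans (H.forest_regions_leR rnw hW K)

end ComponentHistory

/-! ## §4 Sanity, decided: the renewed-and-merged toy -/

namespace SanityR

/-- the root of the renewed-and-merged toy's genealogy is the region born at step `0` [folklore] -/
example : (toyRM.pgenR rnwToy 1 5).rootStep = 0 ∧ (toyRM.pgenR rnwToy 1 5).rootCell = 1 := by decide

end SanityR

end Summit.QuantumFields.BalabanUV.T4Continuum.HistoryGenealogyExtraction
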